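import Summits.QuantumFields.YangMills.Theorems.FemtoCutoffLadderWalledEigenfunctions
import Summits.QuantumFields.YangMills.Theorems.FemtoCutoffLadderWalledL2Infinite
import Summits.QuantumFields.YangMills.Theorems.FemtoCutoffLadderLocalWallCutBound
import Summits.QuantumFields.YangMills.Theorems.FemtoCutoffLadderWalledSecondPos
import HarnessLib

/-!
# Walled TOP PAIR for every SF wall set (brick 5a of the walled spectral package — route `FemtoCutoffLadder`, crux `LocalWallStep`
# stmt-QuantumFields-26282, cancellation route): physical, walled, `l2`-orthonormal `Ω₀, Ω₁` with `1_S K_β Ω₀ = t_Q Ω₀`, `1_S K_β Ω₁ = s_Q Ω₁`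

Seat `leafhand-qf-femtocutoffladder-2` g0 (2026-08-30), `--supports stmt-QuantumFields-26282`.  Instantiates ✓`exists_walledEigenfunctions` (brick 4)
at the wall sets of LINE g5-A / LINE 2: `S = {U | ¬ ∃ p ∈ Q, β^{κ−1} < 2 − Re tr U_p}` (`Q ⊆ Plaquette 3 L` arbitrary; `Q = univ` is the SF wall of
26197/25695).  Inputs: `S` is measurable, gauge- and twist-invariant (✓`measurableSet_wallBad`, conjugation / central twists); `walledL2 L S` is
infinite-dimensional (brick 2 with the open set `{∀ p, dev_p < β^{κ−1}}`, on which `plaqObs` takes the values `1 − 2θ²` of the two-link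
configurations, §1); the first two walled values are positive (✓`walledTop_pos` p615421, sibling ✓`walledSecond_pos` p793746).
★ `exists_walledTopPair`: for `β > 0`, real `κ`, any `Q`: physical `Ω₀, Ω₁` vanishing wherever a plaquette of `Q` is κ-bad, `l2`-orthonormal, with the
POINTWISE hard-wall eigen-equations at the tree's walled values `t Q`, `s Q` (verbatim the `t`, `s` of 26282/26631/26638) and the weak forms
against walled test functions — the object the cancellation route transforms by Doob (`energy_mul_eq`).
HONEST FRAMING: fixed-lattice functional analysis; no estimate; R2b1 RECORD rung — not infinite volume, not a mass gap, not Clay; no summit is proved by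
this file.  No definitions, no named facts, no `sorry`.  [cite: ReedSimonIV1978, Thm. XIII.1]
-/

set_option autoImplicit false

noncomputable section

open MeasureTheory Filter Topology Real
open Literature.MathematicalPhysics.QuantumFieldTheory
open Literature.MathematicalPhysics.QuantumLattice
open Literature.Analysis.OperatorTheory
open scoped InnerProductSpace

namespace Summit.QuantumFields.YangMills.Theorems.FemtoTransferGap.PhysL2

open Summit.QuantumFields.YangMills.Theorems.FemtoTransferGap

variable {L : ℕ} [NeZero L]

/-! ## §1 The SF good set: invariance, an open core on which `plaqObs` is infinite-valued -/

omit [NeZero L] in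
/-- Holonomies of the two-link configuration (`a` on direction `0`, `b` on direction `1`): commutator on `(0,1)` plaquettes, trivial elsewhere. [folklore] -/
theorem plaquetteHolonomy_twoLinkCfg_cases (a b : SU2) (x : Site 3 L) (i j : Fin 3) (hij : i < j) :
    plaquetteHolonomy (twoLinkCfg (L := L) a b) x i j = if i = 0 ∧ j = 1 then a * b * a⁻¹ * b⁻¹ else 1 := by
  fin_cases i <;> fin_cases j <;> simp [plaquetteHolonomy, twoLinkCfg] at hij ⊢

omit [NeZero L] in
/-- Deviations of the two-link configuration `a = chartSU2(θe₀)`, `b = chartSU2(e₁)` (`0 ≤ θ ≤ 1`): `4θ²` on `(0,1)` plaquettes, `0` elsewhere. [folklore] -/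
theorem plaquetteDeviation_twoLinkCfg_cases {θ : ℝ} (hθ : θ ∈ Set.Icc (0 : ℝ) 1) (x : Site 3 L) (i j : Fin 3) (hij : i < j) :
    2 - (su2Rep (plaquetteHolonomy
        (twoLinkCfg (L := L) (chartSU2 (Pi.single 0 θ)) (chartSU2 (Pi.single 1 1))) x i j)).trace.re =
      if i = 0 ∧ j = 1 then 4 * θ ^ 2 else 0 := by
  rw [plaquetteHolonomy_twoLinkCfg_cases _ _ x i j hij]
  split_ifs with h
  · have hc : scalarPart (chartSU2 (Pi.single 0 θ) * chartSU2 (Pi.single 1 1) * (chartSU2 (Pi.single 0 θ))⁻¹ *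
        (chartSU2 (Pi.single 1 1))⁻¹) = 1 - 2 * θ ^ 2 := by
      have h' := plaqObs_twoLinkCfg_chart (L := L) hθ
      rwa [plaqObs, plaquetteHolonomy_twoLinkCfg] at h'
    have hre : (su2Rep (chartSU2 (Pi.single 0 θ) * chartSU2 (Pi.single 1 1) * (chartSU2 (Pi.single 0 θ))⁻¹ *
        (chartSU2 (Pi.single 1 1))⁻¹)).trace.re = 2 * scalarPart (chartSU2 (Pi.single 0 θ) * chartSU2 (Pi.single 1 1) *
        (chartSU2 (Pi.single 0 θ))⁻¹ * (chartSU2 (Pi.single 1 1))⁻¹) :=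
      re_trace_eq_two_mul_scalarPart (chartSU2 (Pi.single 0 θ) * chartSU2 (Pi.single 1 1) * (chartSU2 (Pi.single 0 θ))⁻¹ *
        (chartSU2 (Pi.single 1 1))⁻¹)
    rw [hre, hc]; ring
  · rw [map_one, Matrix.trace_one]; simp

omit [NeZero L] in
/-- **`plaqObs` is infinite-valued on the open SF core** `{U | ∀ p, 2 − Re tr U_p < c}` (`c > 0`): it contains the two-link configurations with
`4θ² < c`, where `plaqObs = 1 − 2θ²`. [folklore] -/
theorem plaqObs_image_sfCore_infinite {c : ℝ} (hc : 0 < c) :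
    (plaqObs L '' {U : GaugeConfig 3 L SU2 | ∀ p : Plaquette 3 L,
      2 - (su2Rep (plaquetteHolonomy U p.1 p.2.1.1 p.2.1.2)).trace.re < c}).Infinite := by
  -- the parameter interval `θ ∈ [0, θ₀]`, `θ₀ = min (1/2) (c/8)` (so `4θ² < c`)
  set θ₀ : ℝ := min (1 / 2) (c / 8) with hθ₀
  have hθ₀pos : 0 < θ₀ := lt_min (by norm_num) (by positivity)
  have hθ₀half : θ₀ ≤ 1 / 2 := min_le_left _ _
  have hθ₀c : θ₀ ≤ c / 8 := min_le_right _ _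
  have hsub : (fun θ : ℝ => 1 - 2 * θ ^ 2) '' Set.Icc (0 : ℝ) θ₀ ⊆ plaqObs L '' {U : GaugeConfig 3 L SU2 | ∀ p : Plaquette 3 L,
      2 - (su2Rep (plaquetteHolonomy U p.1 p.2.1.1 p.2.1.2)).trace.re < c} := by
    rintro _ ⟨θ, hθ, rfl⟩
    have hθI : θ ∈ Set.Icc (0 : ℝ) 1 := ⟨hθ.1, by linarith [hθ.2]⟩
    refine ⟨twoLinkCfg (chartSU2 (Pi.single 0 θ)) (chartSU2 (Pi.single 1 1)), fun p => ?_, plaqObs_twoLinkCfg_chart hθI⟩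
    rw [plaquetteDeviation_twoLinkCfg_cases hθI p.1 p.2.1.1 p.2.1.2 p.2.2]
    split_ifs
    · nlinarith [hθ.1, hθ.2]
    · exact hc
  refine Set.Infinite.mono hsub ((Set.Icc_infinite hθ₀pos).image fun θ hθ θ' hθ' h => ?_)
  have h2 : θ ^ 2 = θ' ^ 2 := by
    have : (1 : ℝ) - 2 * θ ^ 2 = 1 - 2 * θ' ^ 2 := h
    linarith
  nlinarith [hθ.1, hθ'.1, sq_nonneg (θ - θ'), sq_nonneg (θ + θ')]

omit [NeZero L] in
/-- The SF good set of a wall set `Q` is gauge invariant. [folklore] -/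
theorem sfGood_gaugeTransform_iff (c : ℝ) (Q : Set (Plaquette 3 L)) (g : Site 3 L → SU2) (U : GaugeConfig 3 L SU2) :
    gaugeTransform g U ∈ {U : GaugeConfig 3 L SU2 | ¬ ∃ p ∈ Q, c < 2 - (su2Rep (plaquetteHolonomy U p.1 p.2.1.1 p.2.1.2)).trace.re} ↔
      U ∈ {U : GaugeConfig 3 L SU2 | ¬ ∃ p ∈ Q, c < 2 - (su2Rep (plaquetteHolonomy U p.1 p.2.1.1 p.2.1.2)).trace.re} := by
  simp only [Set.mem_setOf_eq]
  refine not_congr (exists_congr fun p => and_congr_right fun _ => ?_)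
  rw [Literature.MathematicalPhysics.QuantumLattice.plaquetteHolonomy_gaugeTransform, SFCompression.trace_su2Rep_conj]

omit [NeZero L] in
/-- The SF good set of a wall set `Q` is twist invariant. [cite: tHooft1979] -/
theorem sfGood_twist_iff (c : ℝ) (Q : Set (Plaquette 3 L)) (k : Fin 3) {z : SU2} (hz : z ∈ Subgroup.center SU2)
    (U : GaugeConfig 3 L SU2) :
    twist k z U ∈ {U : GaugeConfig 3 L SU2 | ¬ ∃ p ∈ Q, c < 2 - (su2Rep (plaquetteHolonomy U p.1 p.2.1.1 p.2.1.2)).trace.re} ↔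
      U ∈ {U : GaugeConfig 3 L SU2 | ¬ ∃ p ∈ Q, c < 2 - (su2Rep (plaquetteHolonomy U p.1 p.2.1.1 p.2.1.2)).trace.re} := by
  simp only [Set.mem_setOf_eq]
  refine not_congr (exists_congr fun p => and_congr_right fun _ => ?_)
  rw [plaquetteHolonomy_twist_of_mem_center k hz U p.1 (ne_of_lt p.2.2)]

omit [NeZero L] in
/-- The wall constraint in «good set» form equals the items' form. [folklore] -/
theorem wallPred_eq (c : ℝ) (Q : Set (Plaquette 3 L)) :
    (fun ψ : GaugeConfig 3 L SU2 → ℝ => ∀ U : GaugeConfig 3 L SU2,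
        U ∉ {U : GaugeConfig 3 L SU2 | ¬ ∃ p ∈ Q, c < 2 - (su2Rep (plaquetteHolonomy U p.1 p.2.1.1 p.2.1.2)).trace.re} → ψ U = 0) =
      fun ψ => ∀ U : GaugeConfig 3 L SU2,
        (∃ p ∈ Q, c < 2 - (su2Rep (plaquetteHolonomy U p.1 p.2.1.1 p.2.1.2)).trace.re) → ψ U = 0 := by
  funext ψ
  simp only [Set.mem_setOf_eq, not_not]

/-! ## §2 ★ The walled top pair -/

/-- ★ **The walled top pair for every SF wall set.**  `β > 0`, real `κ`, `Q ⊆ Plaquette 3 L`; `S = {¬ ∃ p ∈ Q, κ-bad}`.  There are physical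
`Ω₀, Ω₁` vanishing off `S`, `l2`-orthonormal, with `1_S · K_β Ω₀ = t Q · Ω₀` and `1_S · K_β Ω₁ = s Q · Ω₁` POINTWISE (`t Q`, `s Q` the tree's
walled values) and the weak forms `⟨f, K_β Ω_i⟩ = (value) ⟨f, Ω_i⟩` for every walled physical `f`. [cite: ReedSimonIV1978, Thm. XIII.1] -/
theorem exists_walledTopPair {β : ℝ} (hβ : 0 < β) (κ : ℝ) (Q : Set (Plaquette 3 L)) :
    ∃ Ω₀ Ω₁ : GaugeConfig 3 L SU2 → ℝ, IsPhys Ω₀ ∧ IsPhys Ω₁ ∧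
      (∀ U, (∃ p ∈ Q, β ^ (κ - 1) < 2 - (su2Rep (plaquetteHolonomy U p.1 p.2.1.1 p.2.1.2)).trace.re) → Ω₀ U = 0) ∧
      (∀ U, (∃ p ∈ Q, β ^ (κ - 1) < 2 - (su2Rep (plaquetteHolonomy U p.1 p.2.1.1 p.2.1.2)).trace.re) → Ω₁ U = 0) ∧
      l2 Ω₀ Ω₀ = 1 ∧ l2 Ω₁ Ω₁ = 1 ∧ l2 Ω₀ Ω₁ = 0 ∧
      (∀ U, {U : GaugeConfig 3 L SU2 | ¬ ∃ p ∈ Q, β ^ (κ - 1) <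
          2 - (su2Rep (plaquetteHolonomy U p.1 p.2.1.1 p.2.1.2)).trace.re}.indicator (transferApply β Ω₀) U =
        sSup (rayleighSet su2Rep L β fun ψ => ∀ U : GaugeConfig 3 L SU2,
          (∃ p ∈ Q, β ^ (κ - 1) < 2 - (su2Rep (plaquetteHolonomy U p.1 p.2.1.1 p.2.1.2)).trace.re) → ψ U = 0) * Ω₀ U) ∧
      (∀ U, {U : GaugeConfig 3 L SU2 | ¬ ∃ p ∈ Q, β ^ (κ - 1) <
          2 - (su2Rep (plaquetteHolonomy U p.1 p.2.1.1 p.2.1.2)).trace.re}.indicator (transferApply β Ω₁) U =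
        sInf {x : ℝ | ∃ φ : GaugeConfig 3 L SU2 → ℝ, IsPhys φ ∧ x = sSup (rayleighSet su2Rep L β fun ψ =>
          (∀ U : GaugeConfig 3 L SU2,
            (∃ p ∈ Q, β ^ (κ - 1) < 2 - (su2Rep (plaquetteHolonomy U p.1 p.2.1.1 p.2.1.2)).trace.re) → ψ U = 0) ∧
          l2 ψ φ = 0)} * Ω₁ U) ∧
      (∀ f : GaugeConfig 3 L SU2 → ℝ, IsPhys f →
        (∀ U, (∃ p ∈ Q, β ^ (κ - 1) < 2 - (su2Rep (plaquetteHolonomy U p.1 p.2.1.1 p.2.1.2)).trace.re) → f U = 0) →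
        qform su2Rep β f Ω₀ = sSup (rayleighSet su2Rep L β fun ψ => ∀ U : GaugeConfig 3 L SU2,
          (∃ p ∈ Q, β ^ (κ - 1) < 2 - (su2Rep (plaquetteHolonomy U p.1 p.2.1.1 p.2.1.2)).trace.re) → ψ U = 0) * l2 f Ω₀ ∧
        qform su2Rep β f Ω₁ = sInf {x : ℝ | ∃ φ : GaugeConfig 3 L SU2 → ℝ, IsPhys φ ∧ x = sSup (rayleighSet su2Rep L β fun ψ =>
          (∀ U : GaugeConfig 3 L SU2,
            (∃ p ∈ Q, β ^ (κ - 1) < 2 - (su2Rep (plaquetteHolonomy U p.1 p.2.1.1 p.2.1.2)).trace.re) → ψ U = 0) ∧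
          l2 ψ φ = 0)} * l2 f Ω₁) := by
  classical
  set c : ℝ := β ^ (κ - 1) with hcdef
  have hcpos : 0 < c := Real.rpow_pos_of_pos hβ _
  set S : Set (GaugeConfig 3 L SU2) := {U : GaugeConfig 3 L SU2 | ¬ ∃ p ∈ Q,
    c < 2 - (su2Rep (plaquetteHolonomy U p.1 p.2.1.1 p.2.1.2)).trace.re} with hS
  have hSm : MeasurableSet S := (SFCompression.measurableSet_wallBad c Q).compl
  have hSg := sfGood_gaugeTransform_iff (L := L) c Q
  have hSz : ∀ (k : Fin 3), ∀ z ∈ Subgroup.center SU2, ∀ U : GaugeConfig 3 L SU2, twist k z U ∈ S ↔ U ∈ S :=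
    fun k z hz U => sfGood_twist_iff c Q k hz U
  -- infinite dimension: the open SF core lies in `S`
  set O : Set (GaugeConfig 3 L SU2) := {U : GaugeConfig 3 L SU2 | ∀ p : Plaquette 3 L,
    2 - (su2Rep (plaquetteHolonomy U p.1 p.2.1.1 p.2.1.2)).trace.re < c} with hO
  have hOS : O ⊆ S := by
    intro U hU
    simp only [hS, hO, Set.mem_setOf_eq, not_exists, not_and] at hU ⊢
    intro p _ hlt
    exact absurd (hU p) (not_lt.mpr hlt.le)
  have hOopen : IsOpen O := by
    have : O = ⋂ p : Plaquette 3 L, {U | 2 - (su2Rep (plaquetteHolonomy U p.1 p.2.1.1 p.2.1.2)).trace.re < c} := by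
      ext U; simp only [hO, Set.mem_setOf_eq, Set.mem_iInter]
    rw [this]
    exact isOpen_iInter_of_finite fun p => isOpen_lt (SFCompression.continuous_plaquetteDeviation p) continuous_const
  have hinf : ¬ FiniteDimensional ℝ (walledL2 L S) :=
    not_finiteDimensional_walledL2 hSm hSg hSz hOS hOopen (plaqObs_image_sfCore_infinite hcpos)
  -- two walled eigenfunctions; their eigenvalues are positive
  obtain ⟨ev, hanti, hev0, hev1, hrep⟩ := exists_walledEigenfunctions hβ.le hSm hSg hSz hinf 2
  have hpred := wallPred_eq (L := L) c Q
  have hev0' : ev 0 = sSup (rayleighSet su2Rep L β fun ψ => ∀ U : GaugeConfig 3 L SU2,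
      (∃ p ∈ Q, c < 2 - (su2Rep (plaquetteHolonomy U p.1 p.2.1.1 p.2.1.2)).trace.re) → ψ U = 0) := by
    rw [hev0 0 rfl, hpred]
  have hev1' : ev 1 = sInf {x : ℝ | ∃ φ : GaugeConfig 3 L SU2 → ℝ, IsPhys φ ∧ x = sSup (rayleighSet su2Rep L β fun ψ =>
      (∀ U : GaugeConfig 3 L SU2,
        (∃ p ∈ Q, c < 2 - (su2Rep (plaquetteHolonomy U p.1 p.2.1.1 p.2.1.2)).trace.re) → ψ U = 0) ∧ l2 ψ φ = 0)} := by
    rw [hev1 1 rfl]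
    congr 1
    ext x
    simp only [hS, Set.mem_setOf_eq, not_not]
  have hevpos : ∀ j, 0 < ev j := by
    intro j
    have h1 : 0 < ev 1 := by rw [hev1']; exact SFCompression.walledSecond_pos L hβ κ Q
    have hle : ev 1 ≤ ev j := hanti (Fin.le_last j)
    exact h1.trans_le hle
  obtain ⟨φ, hφ, hφS, hon, heig, hweak⟩ := hrep hevpos
  have hφS' : ∀ j U, (∃ p ∈ Q, c < 2 - (su2Rep (plaquetteHolonomy U p.1 p.2.1.1 p.2.1.2)).trace.re) → φ j U = 0 :=
    fun j U hU => hφS j U (fun h => h hU)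
  refine ⟨φ 0, φ 1, hφ 0, hφ 1, hφS' 0, hφS' 1, by simpa using hon 0 0, by simpa using hon 1 1, by simpa using hon 0 1,
    fun U => ?_, fun U => ?_, fun f hf hfS => ⟨?_, ?_⟩⟩
  · rw [← hev0']; exact heig 0 U
  · rw [← hev1']; exact heig 1 U
  · rw [← hev0']
    exact hweak 0 f hf (fun U hU => hfS U (Classical.byContradiction fun h' => hU h'))
  · rw [← hev1']
    exact hweak 1 f hf (fun U hU => hfS U (Classical.byContradiction fun h' => hU h'))

end Summit.QuantumFields.YangMills.Theorems.FemtoTransferGap.PhysL2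

end
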